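import Summits.QuantumAdvantage.AdviceFreeQNC0.ConstantBellsTransfer
import Summits.QuantumAdvantage.AdviceFreeQNC0.WalkTransport
import HarnessLib

/-!
# Constant strategies with at least 21 shots win α's u-walk game on at most `2/3` of the inputs (R0, dense half)

Planner qa-qnc0-p1 g16/g17, route `DWalkThree`, support item `RingFixedBellsSharp3` (stmt-QuantumAdvantage-22487), DENSE half
(ROUND-15 §9.7), in the cell's u-coordinates: a CONSTANT strategy `y_g(u) = [g ∈ B]` of the u-walk game `ringWinU c y`
with `|B| ≥ 21` fired cuts wins on at most `(2/3)·2ⁿ` inputs — in fact on at most `(1 + 3(5/8)^5)/2 · 2ⁿ < 0.644·2ⁿ`.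

PROOF.  `(−1)^{N(u)}` (`N(u)` = the charged fired cuts) is, for each final walk state `τ = n + |u| (mod 3)`, the product of
the bell signs `σ(κ₀ + s_g + τ)` along the walk `s_g = g + W_g(u)` (`κ₀ = c + 2n`); summing over `u` is the path sum of
`ConstantBellsTransfer` (`pathSum_eq`), i.e. `2ⁿ·BV_0(0)`.  Along the backward recursion the squared norm never grows, and
every pair of consecutive bells followed by a further bell contracts it by `5/8` (`pair_contract`); `21` bells give `10` such
pairs, so `|Σ_u (−1)^{N(u)}| ≤ 3·(5/8)^5·2ⁿ < 2ⁿ/3`, whence `3·#win ≤ 2·2ⁿ`.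
Main result: `ConstBells.three_mul_card_win_le` (`21 ≤ |B| → 3·#{u : ringWinU c [·∈B] u} ≤ 2·2ⁿ`).
WHAT THIS IS NOT: the sparse half (≤ 20 bells: a bell-free run + `fixedBellsInnerGap3`) and the ring-language assembly of
`RingFixedBellsSharp3` are in the Theorems file; separation NOT moved.
-/

noncomputable section

namespace Summit.QuantumAdvantage.AdviceFreeQNC0

open Finset Literature.Computability.MetaComplexity

namespace ConstBells

variable {n : ℕ}

/-- The bell sign `σ(z) = +1` if `z = 0`, else `−1`. -/
def sig (z : ZMod 3) : ℝ := if z = 0 then 1 else -1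

/-- The factor family of the constant strategy `BN` for final state `τ`: bell signs at the bells, and the final-state
indicator at cut `n`. -/
def fT (BN : Finset ℕ) (n : ℕ) (κ τ : ZMod 3) : ℕ → ZMod 3 → ℝ := fun j s =>
  (if j ∈ BN then sig (κ + s + τ) else 1) * (if j = n then (if s = τ then 1 else 0) else 1)

/-- The bell sign diagonal is a one-plus pattern: `σ(κ + s + τ) = dOne (−(κ+τ)) s`. -/
theorem sig_eq_dOne (κ τ : ZMod 3) : (fun s => sig (κ + s + τ)) = dOne (-(κ + τ)) := by
  funext s
  unfold sig dOne
  by_cases h : s = -(κ + τ)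
  · rw [if_pos h, if_pos (by rw [h]; ring)]
  · rw [if_neg h, if_neg (by intro h'; apply h; linear_combination h')]

/-- Every factor is bounded by `1`. -/
theorem fT_sq_le (BN : Finset ℕ) (n : ℕ) (κ τ : ZMod 3) (j : ℕ) (s : ZMod 3) : fT BN n κ τ j s ^ 2 ≤ 1 := by
  unfold fT sig
  split_ifs <;> norm_num

/-- At a bell which is not the last cut the factor is the sign diagonal. -/
theorem fT_bell {BN : Finset ℕ} {n j : ℕ} (κ τ : ZMod 3) (hj : j ∈ BN) (hjn : j ≠ n) :
    fT BN n κ τ j = dOne (-(κ + τ)) := by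
  rw [← sig_eq_dOne]; funext s; unfold fT; rw [if_pos hj, if_neg hjn, mul_one]

/-- Off the bells (and off the last cut) the factor is `1`. -/
theorem fT_one {BN : Finset ℕ} {n j : ℕ} (κ τ : ZMod 3) (hj : j ∉ BN) (hjn : j ≠ n) :
    fT BN n κ τ j = fun _ => 1 := by
  funext s; unfold fT; rw [if_neg hj, if_neg hjn, mul_one]

/-- Exactly one of `0, 1, 2` is `τ`. -/
private theorem sum_ite_eq_one (τ : ZMod 3) :
    ((if (0 : ZMod 3) = τ then (1 : ℝ) else 0) + (if (1 : ZMod 3) = τ then (1 : ℝ) else 0) +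
      if (2 : ZMod 3) = τ then (1 : ℝ) else 0) = 1 := by
  have hsum : (∑ s : ZMod 3, if s = τ then (1 : ℝ) else 0) = 1 := by
    rw [Finset.sum_ite_eq' Finset.univ τ (fun _ => (1 : ℝ))]; simp
  have h3 : (∑ s : ZMod 3, if s = τ then (1 : ℝ) else 0) =
      (if (0 : ZMod 3) = τ then (1 : ℝ) else 0) + (if (1 : ZMod 3) = τ then (1 : ℝ) else 0) +
        if (2 : ZMod 3) = τ then (1 : ℝ) else 0 :=
    Fin.sum_univ_three (fun s : ZMod 3 => if s = τ then (1 : ℝ) else 0)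
  rw [← h3, hsum]

/-- The final vector has squared norm `≤ 1`. -/
theorem nsq_fT_last (BN : Finset ℕ) (n : ℕ) (κ τ : ZMod 3) : nsq (fT BN n κ τ n) ≤ 1 := by
  have hle : ∀ s, fT BN n κ τ n s ^ 2 ≤ if s = τ then 1 else 0 := by
    intro s; unfold fT; rw [if_pos rfl]
    by_cases hs : s = τ
    · rw [if_pos hs, mul_one]; unfold sig; split_ifs <;> norm_num
    · rw [if_neg hs, mul_zero]; norm_num
  unfold nsq
  have h0 := hle 0
  have h1 := hle 1
  have h2 := hle 2
  have h := sum_ite_eq_one τ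
  linarith

/-! ### The chain of pair contractions -/

/-- **Chain lemma**: along `2t+1` consecutive bells `b 0 < b 1 < ⋯ < b (2t) ≤ n` (no bell strictly between consecutive ones)
the backward vector at `b 0` has squared norm `≤ (5/8)^t`. -/
theorem nsq_BV_chain (BN : Finset ℕ) (n : ℕ) (κ τ : ZMod 3) (t : ℕ) :
    ∀ b : ℕ → ℕ, (∀ i, i < 2 * t → b i < b (i + 1)) → b (2 * t) ≤ n → (∀ i, i ≤ 2 * t → b i ∈ BN) →
      (∀ i, i < 2 * t → ∀ j, b i < j → j < b (i + 1) → j ∉ BN) →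
      nsq (BV (fT BN n κ τ) (b 0) (n - b 0)) ≤ (5 / 8 : ℝ) ^ t := by
  induction t with
  | zero =>
    intro b _ hbn _ _
    rw [pow_zero]
    calc nsq (BV (fT BN n κ τ) (b 0) (n - b 0))
        ≤ nsq (BV (fT BN n κ τ) (b 0 + (n - b 0)) (n - b 0 - (n - b 0))) :=
          nsq_BV_le _ (fT_sq_le BN n κ τ) _ _ _ le_rfl
      _ ≤ 1 := by
          rw [show b 0 + (n - b 0) = n from by simp at hbn; omega, Nat.sub_self, nsq_BV_zero]
          exact nsq_fT_last BN n κ τ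
  | succ t ih =>
    intro b hmono hbn hmem hgap
    have h01 : b 0 < b 1 := hmono 0 (by omega)
    have h12 : b 1 < b 2 := hmono 1 (by omega)
    have hle : ∀ k, k ≤ 2 * (t + 1) → ∀ i, i ≤ k → b i ≤ b k := by
      intro k hk
      induction k with
      | zero => intro i hi; rw [Nat.le_zero.mp hi]
      | succ k ihk =>
        intro i hi
        rcases Nat.lt_or_ge i (k + 1) with hlt | hge
        · exact ((ihk (by omega) i (by omega)).trans (hmono k (by omega)).le)
        · rw [show i = k + 1 from by omega]
    have h2n : b 2 ≤ n := (hle (2 * (t + 1)) le_rfl 2 (by omega)).trans hbn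
    -- unroll the first two bells
    have hb0n : b 0 ≠ n := by omega
    have hb1n : b 1 ≠ n := by omega
    have hu0 : BV (fT BN n κ τ) (b 0) (n - b 0) =
        sgnMul (dOne (-(κ + τ))) (avg^[b 1 - b 0] (BV (fT BN n κ τ) (b 1) (n - b 1))) := by
      have h := BV_unroll_bell (fT BN n κ τ) (show 1 ≤ b 1 - b 0 by omega) (b 0) (n - b 1)
        (fun j h1 h2 => fT_one κ τ (hgap 0 (by omega) j h1 (by show j < b 1; omega)) (by omega))
      rw [show b 1 - b 0 + (n - b 1) = n - b 0 from by omega, show b 0 + (b 1 - b 0) = b 1 from by omega,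
        fT_bell κ τ (hmem 0 (by omega)) hb0n] at h
      exact h
    have hu1 : BV (fT BN n κ τ) (b 1) (n - b 1) =
        sgnMul (dOne (-(κ + τ))) (avg^[b 2 - b 1] (BV (fT BN n κ τ) (b 2) (n - b 2))) := by
      have h := BV_unroll_bell (fT BN n κ τ) (show 1 ≤ b 2 - b 1 by omega) (b 1) (n - b 2)
        (fun j h1 h2 => fT_one κ τ (hgap 1 (by omega) j h1 (by show j < b 2; omega)) (by omega))
      rw [show b 2 - b 1 + (n - b 2) = n - b 1 from by omega, show b 1 + (b 2 - b 1) = b 2 from by omega,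
        fT_bell κ τ (hmem 1 (by omega)) hb1n] at h
      exact h
    rw [hu0, hu1]
    have hrest := ih (fun i => b (i + 2)) (fun i hi => hmono (i + 2) (by omega))
      (by rw [show 2 * t + 2 = 2 * (t + 1) from by ring]; exact hbn) (fun i hi => hmem (i + 2) (by omega))
      (fun i hi j h1 h2 => hgap (i + 2) (by omega) j h1 h2)
    calc nsq (sgnMul (dOne (-(κ + τ))) (avg^[b 1 - b 0]
          (sgnMul (dOne (-(κ + τ))) (avg^[b 2 - b 1] (BV (fT BN n κ τ) (b 2) (n - b 2))))))
        ≤ 5 / 8 * nsq (BV (fT BN n κ τ) (b 2) (n - b 2)) :=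
          pair_contract _ (by omega) (by omega) _
      _ ≤ 5 / 8 * (5 / 8 : ℝ) ^ t := by gcongr
      _ = (5 / 8 : ℝ) ^ (t + 1) := by ring

/-! ### The constant strategy and its signed count -/

/-- The walk state at cut `j`: `s_j = j + W_j(u) (mod 3)`. -/
def st (u : Fin n → Bool) (j : ℕ) : ZMod 3 := ((j + wtPrefix u j : ℕ) : ZMod 3)

/-- The constant strategy firing the fixed cut set `B`. -/
def constY (B : Finset (Fin (n + 1))) : Fin (n + 1) → (Fin n → Bool) → Bool := fun g _ => decide (g ∈ B)

/-- The fired cuts as natural numbers. -/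
def bellsN (B : Finset (Fin (n + 1))) : Finset ℕ := B.map Fin.valEmbedding

/-- Membership in `bellsN`. -/
theorem mem_bellsN {B : Finset (Fin (n + 1))} {j : ℕ} : j ∈ bellsN B ↔ ∃ g ∈ B, g.val = j := by
  unfold bellsN; simp

/-- Fired cuts are `≤ n`. -/
theorem bellsN_le {B : Finset (Fin (n + 1))} {j : ℕ} (h : j ∈ bellsN B) : j ≤ n := by
  obtain ⟨g, _, rfl⟩ := mem_bellsN.1 h; have := g.isLt; omega

/-- `bellsN` has the cardinality of `B`. -/
theorem card_bellsN (B : Finset (Fin (n + 1))) : (bellsN B).card = B.card := Finset.card_map _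

/-- `W_n = |u|`. -/
theorem wtPrefix_self (u : Fin n → Bool) : wtPrefix u n = wt u := by
  unfold wtPrefix wt; congr 1; ext i; simp

/-- The charge condition at cut `j` in terms of the walk states: `c + j + e_j(u) ≢ 0 ⟺ κ₀ + s_j + s_n ≠ 0`, `κ₀ = c + 2n`. -/
theorem charge_iff (c : ℕ) (u : Fin n → Bool) (j : ℕ) :
    (c + j + walkExp u j) % 3 ≠ 0 ↔ ((c + 2 * n : ℕ) : ZMod 3) + st u j + st u n ≠ 0 := by
  unfold walkExp st
  rw [wtPrefix_self]
  have hcast : ((c + 2 * n : ℕ) : ZMod 3) + ((j + wtPrefix u j : ℕ) : ZMod 3) + ((n + wt u : ℕ) : ZMod 3) =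
      ((c + j + (wt u + wtPrefix u j) + 3 * n : ℕ) : ZMod 3) := by push_cast; ring
  rw [hcast, ne_eq, ne_eq, ZMod.natCast_eq_zero_iff]
  omega

/-- The sign of the outcome: `−1` if the constant strategy wins at `u`, `+1` otherwise. -/
def sgnU (c : ℕ) (B : Finset (Fin (n + 1))) (u : Fin n → Bool) : ℝ :=
  if ringWinU c (constY B) u = true then -1 else 1

/-- `(−1)^k` as `±1`. -/
private theorem neg_one_pow_ite (k : ℕ) : ((-1 : ℝ)) ^ k = if k % 2 = 1 then -1 else 1 := by
  rcases Nat.even_or_odd k with h | h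
  · rw [h.neg_one_pow, if_neg (by rw [Nat.even_iff] at h; omega)]
  · rw [h.neg_one_pow, if_pos (Nat.odd_iff.mp h)]

/-- **The sign as a sum over final states of the factor products** (transfer form of one input). -/
theorem sgnU_eq_sum (c : ℕ) (B : Finset (Fin (n + 1))) (u : Fin n → Bool) :
    sgnU c B u = ∑ τ : ZMod 3, ∏ j ∈ range (n + 1),
      fT (bellsN B) n (((c + 2 * n : ℕ) : ZMod 3)) τ j (st u j) := by
  classical
  set κ : ZMod 3 := ((c + 2 * n : ℕ) : ZMod 3) with hκ
  -- each product splits off the final-state indicator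
  have hprod : ∀ τ : ZMod 3, (∏ j ∈ range (n + 1), fT (bellsN B) n κ τ j (st u j)) =
      (∏ j ∈ range (n + 1), (if j ∈ bellsN B then sig (κ + st u j + τ) else 1)) *
        (if st u n = τ then 1 else 0) := by
    intro τ
    unfold fT
    rw [Finset.prod_mul_distrib]
    congr 1
    rw [Finset.prod_ite_eq' (range (n + 1)) n (fun j => if st u j = τ then (1 : ℝ) else 0), if_pos (by simp)]
  simp_rw [hprod]
  rw [show (∑ τ : ZMod 3, (∏ j ∈ range (n + 1), (if j ∈ bellsN B then sig (κ + st u j + τ) else 1)) *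
      (if st u n = τ then 1 else 0)) = ∑ τ : ZMod 3, (if st u n = τ then
        (∏ j ∈ range (n + 1), (if j ∈ bellsN B then sig (κ + st u j + τ) else 1)) else 0) from
      Finset.sum_congr rfl fun τ _ => by split_ifs <;> simp]
  rw [Finset.sum_ite_eq, if_pos (mem_univ _)]
  -- the product over the bells is `(−1)^{#charged bells}`
  rw [Finset.prod_ite, Finset.prod_const_one, mul_one, Finset.filter_mem_eq_inter,
    (Finset.inter_eq_right.2 (fun j hj => mem_range.2 (Nat.lt_succ_of_le (bellsN_le hj)) : bellsN B ⊆ range (n + 1)))]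
  unfold sig
  rw [Finset.prod_ite, Finset.prod_const_one, one_mul, Finset.prod_const, neg_one_pow_ite]
  -- compare with the winning count of the constant strategy
  unfold sgnU ringWinU constY
  have hcard : ((bellsN B).filter fun j => ¬ (κ + st u j + st u n = 0)).card =
      (univ.filter fun g : Fin (n + 1) => decide (g ∈ B) = true ∧ (c + g.val + walkExp u g.val) % 3 ≠ 0).card := by
    have h1 : (univ.filter fun g : Fin (n + 1) => decide (g ∈ B) = true ∧ (c + g.val + walkExp u g.val) % 3 ≠ 0) =
        B.filter fun g : Fin (n + 1) => ¬ (κ + st u g.val + st u n = 0) := by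
      ext g
      simp only [mem_filter, mem_univ, true_and, decide_eq_true_eq]
      rw [charge_iff c u g.val]
    rw [h1]
    unfold bellsN
    rw [Finset.filter_map, Finset.card_map]
    rfl
  rw [hcard]
  by_cases hw : (univ.filter fun g : Fin (n + 1) =>
      decide (g ∈ B) = true ∧ (c + g.val + walkExp u g.val) % 3 ≠ 0).card % 2 = 1
  · rw [if_pos hw, if_pos (decide_eq_true hw)]
  · rw [if_neg hw, if_neg (by rw [decide_eq_false hw]; exact Bool.false_ne_true)]

/-- `Σ_u sgnU = 2ⁿ − 2·#win`. -/
theorem sum_sgnU (c : ℕ) (B : Finset (Fin (n + 1))) :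
    (∑ u : Fin n → Bool, sgnU c B u) =
      (2 : ℝ) ^ n - 2 * ((univ.filter fun u : Fin n → Bool => ringWinU c (constY B) u = true).card : ℝ) := by
  have h : ∀ u : Fin n → Bool, sgnU c B u = 1 - 2 * (if ringWinU c (constY B) u = true then (1 : ℝ) else 0) := by
    intro u; unfold sgnU; split_ifs <;> norm_num
  simp_rw [h]
  rw [Finset.sum_sub_distrib, ← Finset.mul_sum, Finset.sum_boole, Finset.sum_const, Finset.card_univ,
    Fintype.card_fun, Fintype.card_bool, Fintype.card_fin]
  simp

/-- **The signed count is small**: with at least `21` fired cuts, `|Σ_u sgnU| ≤ 3·(5/8)^5·2ⁿ`; precisely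
`Σ_u sgnU ≥ −3·(5/8)^5·2ⁿ`. -/
theorem sum_sgnU_ge (c : ℕ) (B : Finset (Fin (n + 1))) (hB : 21 ≤ B.card) :
    -(3 * (5 / 8 : ℝ) ^ 5 * (2 : ℝ) ^ n) ≤ ∑ u : Fin n → Bool, sgnU c B u := by
  classical
  set κ : ZMod 3 := ((c + 2 * n : ℕ) : ZMod 3) with hκ
  set BN := bellsN B with hBN
  -- transfer form
  have htr : (∑ u : Fin n → Bool, sgnU c B u) = ∑ τ : ZMod 3, (2 : ℝ) ^ n * BV (fT BN n κ τ) 0 n 0 := by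
    simp_rw [sgnU_eq_sum]
    rw [Finset.sum_comm]
    refine Finset.sum_congr rfl fun τ _ => ?_
    have h := pathSum_eq (fT BN n κ τ) n 0 0
    simp only [zero_add] at h
    exact h
  -- the 21 smallest bells
  have hcardBN : 21 ≤ BN.card := by rw [hBN, card_bellsN]; exact hB
  let e := BN.orderEmbOfFin rfl
  let b : ℕ → ℕ := fun i => if h : i < BN.card then e ⟨i, h⟩ else 0
  have hb : ∀ i (h : i < BN.card), b i = e ⟨i, h⟩ := fun i h => by simp only [b, dif_pos h]
  have hmono : ∀ i, i < 2 * 10 → b i < b (i + 1) := by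
    intro i hi
    rw [hb i (by omega), hb (i + 1) (by omega)]
    exact e.strictMono (by simp)
  have hmem : ∀ i, i ≤ 2 * 10 → b i ∈ BN := by
    intro i hi; rw [hb i (by omega)]; exact Finset.orderEmbOfFin_mem BN rfl _
  have hgap : ∀ i, i < 2 * 10 → ∀ j, b i < j → j < b (i + 1) → j ∉ BN := by
    intro i hi j h1 h2 hj
    have hjr : j ∈ Set.range e := by rw [Finset.range_orderEmbOfFin]; exact hj
    obtain ⟨k, hk⟩ := hjr
    rw [hb i (by omega)] at h1
    rw [hb (i + 1) (by omega)] at h2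
    rw [← hk] at h1 h2
    have hk1 : (⟨i, by omega⟩ : Fin BN.card) < k := e.strictMono.lt_iff_lt.mp h1
    have hk2 : k < ⟨i + 1, by omega⟩ := e.strictMono.lt_iff_lt.mp h2
    rw [Fin.lt_def] at hk1 hk2
    simp only at hk1 hk2
    omega
  have hbn : b (2 * 10) ≤ n := bellsN_le (hmem _ le_rfl)
  -- each final state contributes at most `(5/8)^5 · 2ⁿ` in absolute value
  have hτ : ∀ τ : ZMod 3, -((5 / 8 : ℝ) ^ 5) ≤ BV (fT BN n κ τ) 0 n 0 := by
    intro τ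
    have hchain := nsq_BV_chain BN n κ τ 10 b hmono hbn hmem hgap
    have h0 : nsq (BV (fT BN n κ τ) 0 n) ≤ nsq (BV (fT BN n κ τ) (b 0) (n - b 0)) := by
      have h := nsq_BV_le (fT BN n κ τ) (fT_sq_le BN n κ τ) n 0 (b 0) ((bellsN_le (hmem 0 (by omega))))
      rwa [zero_add] at h
    have hsq : (BV (fT BN n κ τ) 0 n 0) ^ 2 ≤ ((5 / 8 : ℝ) ^ 5) ^ 2 := by
      calc (BV (fT BN n κ τ) 0 n 0) ^ 2 ≤ nsq (BV (fT BN n κ τ) 0 n) := sq_le_nsq _ 0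
        _ ≤ (5 / 8 : ℝ) ^ 10 := h0.trans hchain
        _ = ((5 / 8 : ℝ) ^ 5) ^ 2 := by norm_num
    have habs := abs_le_of_sq_le_sq hsq (by positivity)
    rw [abs_le] at habs
    exact habs.1
  have h3 : (∑ τ : ZMod 3, (2 : ℝ) ^ n * BV (fT BN n κ τ) 0 n 0) =
      (2 : ℝ) ^ n * BV (fT BN n κ 0) 0 n 0 + (2 : ℝ) ^ n * BV (fT BN n κ 1) 0 n 0 +
        (2 : ℝ) ^ n * BV (fT BN n κ 2) 0 n 0 :=
    Fin.sum_univ_three (fun τ : ZMod 3 => (2 : ℝ) ^ n * BV (fT BN n κ τ) 0 n 0)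
  rw [htr, h3]
  have h2n : (0 : ℝ) ≤ (2 : ℝ) ^ n := by positivity
  have t0 := mul_le_mul_of_nonneg_left (hτ 0) h2n
  have t1 := mul_le_mul_of_nonneg_left (hτ 1) h2n
  have t2 := mul_le_mul_of_nonneg_left (hτ 2) h2n
  linarith

/-- **R0, dense half — PROVED**: a constant strategy firing at least `21` cuts wins α's u-walk game on at most
`(2/3)·2ⁿ` inputs: `3·#win ≤ 2·2ⁿ`. -/
theorem three_mul_card_win_le (c : ℕ) (B : Finset (Fin (n + 1))) (hB : 21 ≤ B.card) :
    3 * (univ.filter fun u : Fin n → Bool => ringWinU c (constY B) u = true).card ≤ 2 * 2 ^ n := by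
  have h1 := sum_sgnU c B
  have h2 := sum_sgnU_ge c B hB
  rw [h1] at h2
  have h2n : (0 : ℝ) ≤ (2 : ℝ) ^ n := by positivity
  have hnum : 3 * (5 / 8 : ℝ) ^ 5 ≤ 1 / 3 := by norm_num
  have hreal : (3 : ℝ) * ((univ.filter fun u : Fin n → Bool => ringWinU c (constY B) u = true).card : ℝ) ≤
      2 * (2 : ℝ) ^ n := by nlinarith
  exact_mod_cast hreal

end ConstBells

end Summit.QuantumAdvantage.AdviceFreeQNC0

end
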